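import Mathlib
import Summits.NavierStokesRegularity.NavierStokesRegularity.Theorems.WakeRatchetTailRatchetRelayDrainFreeSignChange
import HarnessLib

/-!
# `WakeRatchet.TailRatchet` (stmt-NavierStokesRegularity-21808): the drain-free front equation for time ratio
# `1 < s < 2` — exponential lower bound for positive solutions, and what integrability forces (census item G0(ii), part 1)

Support file for the crux `TailRatchet` (route `WakeRatchet`; MODEL lattice ODEs of Tao 2016 §1.2, §4 — nothing
in this file is a statement about the Navier–Stokes equations, and no item is closed here).

Context (census of stmt-21808, continuation programme "R-glob", step G0 «drain-free rigidity»; companion of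
`…RelayDrainFreeSignChange`, which treats `s > 2`).  For the drain-free scalar front equation
`b' = (4/s²) b(t/s)²` on `t < 0` with `1 < s < 2`:

* `lower_bound` — every solution positive on `(−∞,0]` obeys `b(t) ≥ b(0)·exp((4/s²) b(0) t)`: with `ℓ = log b`
  and `D(t) = 2ℓ(t/s) − ℓ(t)`, `D' = (4/s²)[(2/s)e^{D(t/s)} − e^{D}]` is POSITIVE (largest-bad-point argument,
  `2/s > 1`), so `D < D(0) = log b(0)` and `ℓ' = (4/s²)e^{D} < (4/s²)b(0)`;
* `monotoneOn`, `exists_lt_of_integrableOn`, `tail_small` — a solution is non-decreasing; an integrable one takes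
  arbitrarily small values far out, and (if non-negative) has `|t|·b(t)` small on a whole half-line
  (`(s−1)|t| b(st) ≤ ∫_{[st,t]} b → 0`).

The companion `…RelayDrainFreeSlowDecay` turns this into NON-INTEGRABILITY of every positive solution for
`1 < s < 2` (squaring step `|t|b ≤ M on t ≤ T ⇒ |t|b ≤ 4M² on t ≤ sT`, doubly-exponential decay against the
exponential lower bound); with `…RelayDrainFreeSignChange` (`s > 2`) the drain-free axis `δ = 0` then carries an
admissible front ONLY at the relay ratio `s = 2` (`…RelayDrainFreeRigidity`).  NUMERICAL REMARK
(session script, not used): for `s < e^{π/(3√3)} ≈ 1.83` the tail is `b ≈ 1/(4|t|)`; for `1.83 < s < 2` it is a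
positive LOG-PERIODIC tail `p(log|t|)/|t|` (Hopf bifurcation of the plateau of `ψ' = ψ − 4ψ(·−log s)²` at
`log s = π/(3√3)`, limit cycle growing into the Gumbel homoclinic pulse at `s = 2`) — non-integrable either way.

HONEST FRAMING: elementary real analysis of a MODEL functional ODE; the construction item and the crux stay open;
nothing here concerns Navier–Stokes.
-/

noncomputable section

set_option linter.dupNamespace false

namespace Summit.NavierStokesRegularity.NavierStokesRegularity.Theorems

namespace WakeRatchetRelayDrainFreeSlow

open Set Filter Topology MeasureTheory
open WakeRatchetRelayDrainFreeSignChange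

variable {s : ℝ} {b : ℝ → ℝ}

/-! ## The sub-exponential lower bound (`1 < s < 2`) -/

/-- **Exponential lower bound for `1 < s < 2`.**  A solution of `b' = (4/s²)b(t/s)²` (`t < 0`), continuous and
positive on `(−∞,0]`, satisfies `b(0)·exp((4/s²)b(0)·t) ≤ b(t)` for every `t ≤ 0`.
[cite: Tao2016AveragedNS, §1.2 (dyadic model); cell vocabulary (drain-free scalar front equation of `DyadicScalarFronts`, census item G0 of stmt-21808)] -/
theorem lower_bound (hs1 : 1 < s) (hs2 : s < 2) (hc : ContinuousOn b (Iic 0))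
    (hd : ∀ t : ℝ, t < 0 → HasDerivAt b (4 / s ^ 2 * b (t / s) ^ 2) t)
    (hpos : ∀ t : ℝ, t ≤ 0 → 0 < b t) {t : ℝ} (ht : t ≤ 0) :
    b 0 * Real.exp (4 / s ^ 2 * b 0 * t) ≤ b t := by
  have hs0 : 0 < s := by linarith
  have hs1' : (1 : ℝ) ≤ s := hs1.le
  set D : ℝ → ℝ := fun x => 2 * Real.log (b (x / s)) - Real.log (b x) with hD
  set G : ℝ → ℝ := fun x => 4 / s ^ 2 * (2 / s * Real.exp (D (x / s)) - Real.exp (D x)) with hG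
  have hmem : ∀ t : ℝ, t ≤ 0 → t / s ≤ 0 := fun t ht => (div_mem_of_nonpos hs1' ht).2
  have hD' : ∀ t : ℝ, t < 0 → HasDerivAt D (G t) t := fun t ht =>
    hasDerivAt_defect hd hs1 ht (hpos t ht.le) (hpos _ (hmem t ht.le)) (hpos _ (hmem _ (hmem t ht.le)))
  have hlogc : ContinuousOn (fun x => Real.log (b x)) (Iic 0) := hc.log fun x hx => (hpos x hx).ne'
  have hlogsc : ContinuousOn (fun x => Real.log (b (x / s))) (Iic 0) :=
    hlogc.comp (continuousOn_id.div_const s) fun x hx => hmem x hx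
  have hDc : ContinuousOn D (Iic 0) := (hlogsc.const_smul (2 : ℝ)).sub hlogc |>.congr fun x _ => by
    simp [hD, smul_eq_mul]
  have hDsc : ContinuousOn (fun x => D (x / s)) (Iic 0) :=
    hDc.comp (continuousOn_id.div_const s) fun x hx => hmem x hx
  have hGc : ContinuousOn G (Iic 0) := by
    have h1 : ContinuousOn (fun x => Real.exp (D (x / s))) (Iic 0) :=
      Real.continuous_exp.comp_continuousOn hDsc
    have h2 : ContinuousOn (fun x => Real.exp (D x)) (Iic 0) :=
      Real.continuous_exp.comp_continuousOn hDc
    exact ((h1.const_smul (2 / s)).sub h2).const_smul (4 / s ^ 2) |>.congr fun x _ => by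
      simp [hG, smul_eq_mul]
  have h2s : 1 < 2 / s := by rw [lt_div_iff₀ hs0]; linarith
  have h4s : 0 < 4 / s ^ 2 := by positivity
  -- `G(t) > 0` as soon as `D(t) < D(t/s)`
  have hGpos_of : ∀ t, D t < D (t / s) → 0 < G t := by
    intro t hlt
    have h1 : Real.exp (D t) < Real.exp (D (t / s)) := Real.exp_lt_exp.2 hlt
    have h2 : Real.exp (D t) < 2 / s * Real.exp (D (t / s)) := by
      calc Real.exp (D t) = 1 * Real.exp (D t) := (one_mul _).symm
        _ < 2 / s * Real.exp (D t) := mul_lt_mul_of_pos_right h2s (Real.exp_pos _)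
        _ < 2 / s * Real.exp (D (t / s)) := mul_lt_mul_of_pos_left h1 (by positivity)
    show 0 < 4 / s ^ 2 * (2 / s * Real.exp (D (t / s)) - Real.exp (D t))
    exact mul_pos h4s (by linarith)
  have hG0 : 0 < G 0 := by
    have : D (0 / s) = D 0 := by rw [zero_div]
    show 0 < 4 / s ^ 2 * (2 / s * Real.exp (D (0 / s)) - Real.exp (D 0))
    rw [this]
    have h4 : 1 * Real.exp (D 0) < 2 / s * Real.exp (D 0) := mul_lt_mul_of_pos_right h2s (Real.exp_pos _)
    exact mul_pos h4s (by linarith)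
  have hmono_of : ∀ τ : ℝ, τ ≤ 0 → (∀ t ∈ Ioo τ 0, 0 < G t) → StrictMonoOn D (Icc τ 0) := by
    intro τ hτ hposG
    refine strictMonoOn_of_deriv_pos (convex_Icc τ 0) (hDc.mono fun x hx => hx.2) ?_
    intro x hx
    rw [interior_Icc] at hx
    rw [(hD' x hx.2).deriv]
    exact hposG x hx
  -- Step 1: `G > 0` on `(−∞, 0]`
  have hGpos : ∀ t : ℝ, t ≤ 0 → 0 < G t := by
    by_contra hcon
    push Not at hcon
    obtain ⟨t₀, ht₀, hGt₀⟩ := hcon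
    set Bad : Set ℝ := Icc t₀ 0 ∩ G ⁻¹' Iic 0 with hBad
    have hBclosed : IsClosed Bad :=
      (hGc.mono fun x hx => hx.2).preimage_isClosed_of_isClosed isClosed_Icc isClosed_Iic
    have hBne : Bad.Nonempty := ⟨t₀, ⟨le_rfl, ht₀⟩, hGt₀⟩
    have hBbdd : BddAbove Bad := ⟨0, fun x hx => hx.1.2⟩
    set t₁ := sSup Bad with ht₁
    have ht₁mem : t₁ ∈ Bad := hBclosed.csSup_mem hBne hBbdd
    have ht₁0 : t₁ ≤ 0 := ht₁mem.1.2
    have hGt₁ : G t₁ ≤ 0 := ht₁mem.2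
    have ht₁ne : t₁ ≠ 0 := fun h => by rw [h] at hGt₁; linarith
    have ht₁lt : t₁ < 0 := lt_of_le_of_ne ht₁0 ht₁ne
    have hafter : ∀ t ∈ Ioo t₁ 0, 0 < G t := by
      intro t ht
      by_contra h
      push Not at h
      have : t ≤ t₁ := le_csSup hBbdd ⟨⟨ht₁mem.1.1.trans ht.1.le, ht.2.le⟩, h⟩
      linarith [ht.1]
    have hmono := hmono_of t₁ ht₁0 hafter
    have hlt : t₁ < t₁ / s := lt_div_of_neg hs1 ht₁lt
    have hmem₁ : t₁ / s ∈ Icc t₁ 0 := ⟨hlt.le, hmem t₁ ht₁0⟩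
    have hDlt : D t₁ < D (t₁ / s) := hmono ⟨le_rfl, ht₁0⟩ hmem₁ hlt
    linarith [hGpos_of t₁ hDlt]
  -- Step 2: `D` strictly increasing on `(−∞, 0]`, so `D(t) < D(0) = log b(0)` for `t < 0`
  have hmono : StrictMonoOn D (Iic 0) := by
    refine strictMonoOn_of_deriv_pos (convex_Iic 0) hDc ?_
    intro x hx
    rw [interior_Iic] at hx
    rw [(hD' x hx).deriv]
    exact hGpos x (le_of_lt hx)
  have hD0 : D 0 = Real.log (b 0) := by
    show 2 * Real.log (b (0 / s)) - Real.log (b 0) = Real.log (b 0)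
    rw [zero_div]; ring
  -- Step 3: `(log b)' ≤ (4/s²) b(0)` on `(−∞, 0)`
  set β : ℝ := 4 / s ^ 2 * b 0 with hβ
  have hℓ' : ∀ t : ℝ, t < 0 → HasDerivAt (fun x => Real.log (b x)) (4 / s ^ 2 * Real.exp (D t)) t :=
    fun t ht => hasDerivAt_log hd ht (hpos t ht.le) (hpos _ (hmem t ht.le))
  have hℓ'le : ∀ t : ℝ, t < 0 → 4 / s ^ 2 * Real.exp (D t) ≤ β := by
    intro t ht
    have h1 : D t < D 0 := hmono (le_of_lt ht) (le_refl (0 : ℝ)) ht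
    rw [hD0] at h1
    have h2 : Real.exp (D t) < b 0 := by
      calc Real.exp (D t) < Real.exp (Real.log (b 0)) := Real.exp_lt_exp.2 h1
        _ = b 0 := Real.exp_log (hpos 0 le_rfl)
    rw [hβ]
    exact mul_le_mul_of_nonneg_left h2.le h4s.le
  have hdiff : DifferentiableOn ℝ (fun x => Real.log (b x)) (interior (Iic 0)) := by
    rw [interior_Iic]; intro x hx; exact (hℓ' x hx).differentiableAt.differentiableWithinAt
  have hderiv : ∀ x ∈ interior (Iic (0 : ℝ)), deriv (fun x => Real.log (b x)) x ≤ β := by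
    rw [interior_Iic]; intro x hx
    rw [(hℓ' x hx).deriv]
    exact hℓ'le x hx
  have hMVT := (convex_Iic (0 : ℝ)).image_sub_le_mul_sub_of_deriv_le hlogc hdiff hderiv t ht 0 self_mem_Iic ht
  -- Step 4: exponentiate
  have h1 : Real.log (b 0) + β * t ≤ Real.log (b t) := by linarith
  calc b 0 * Real.exp (4 / s ^ 2 * b 0 * t) = Real.exp (Real.log (b 0) + β * t) := by
        rw [Real.exp_add, Real.exp_log (hpos 0 le_rfl)]
    _ ≤ Real.exp (Real.log (b t)) := Real.exp_le_exp.2 h1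
    _ = b t := Real.exp_log (hpos t ht)

/-! ## Monotonicity and the consequences of integrability -/

/-- A solution of the drain-free equation, continuous on `(−∞,0]`, is non-decreasing there (`b' ≥ 0`).
[folklore] -/
theorem monotoneOn (hc : ContinuousOn b (Iic 0))
    (hd : ∀ t : ℝ, t < 0 → HasDerivAt b (4 / s ^ 2 * b (t / s) ^ 2) t) : MonotoneOn b (Iic 0) := by
  refine monotoneOn_of_deriv_nonneg (convex_Iic 0) hc ?_ ?_
  · rw [interior_Iic]; intro x hx; exact (hd x hx).differentiableAt.differentiableWithinAt
  · rw [interior_Iic]; intro x hx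
    rw [(hd x hx).deriv]
    positivity

/-- A function integrable on `(−∞,0)` takes values below any `ε > 0` arbitrarily far out. [folklore] -/
theorem exists_lt_of_integrableOn (hint : IntegrableOn b (Iio 0))
    {ε : ℝ} (hε : 0 < ε) {T : ℝ} (hT : T ≤ 0) : ∃ T' : ℝ, T' ≤ T ∧ b T' < ε := by
  by_contra hcon
  push Not at hcon
  have hfin := Integrable.measure_norm_ge_lt_top hint hε
  have hsub : Iio T ⊆ {x | ε ≤ ‖b x‖} := by
    intro x hx
    have h1 : ε ≤ b x := hcon x (le_of_lt hx)
    show ε ≤ ‖b x‖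
    rw [Real.norm_of_nonneg (hε.le.trans h1)]
    exact h1
  have hIio : (volume.restrict (Iio (0 : ℝ))) (Iio T) = ⊤ := by
    rw [Measure.restrict_apply measurableSet_Iio,
      inter_eq_left.2 (Iio_subset_Iio hT), Real.volume_Iio]
  have := measure_mono (μ := volume.restrict (Iio (0 : ℝ))) hsub
  rw [hIio, top_le_iff] at this
  exact hfin.ne this

/-- **Integrability makes `|t|·b(t)` small on a half-line** (for a non-negative non-decreasing `b`).
[folklore] -/
theorem tail_small (hs1 : 1 < s) (hmono : MonotoneOn b (Iic 0)) (hnonneg : ∀ t : ℝ, t ≤ 0 → 0 ≤ b t)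
    (hint : IntegrableOn b (Iio 0)) {ε : ℝ} (hε : 0 < ε) :
    ∃ T₀ : ℝ, T₀ < 0 ∧ ∀ t : ℝ, t ≤ T₀ → (-t) * b t ≤ ε := by
  have hs0 : 0 < s := by linarith
  -- tails of the integral tend to zero
  set S : ℕ → Set ℝ := fun n => Iic (-(n : ℝ) - 1) with hS
  have hsm : ∀ n, MeasurableSet (S n) := fun n => measurableSet_Iic
  have hanti : Antitone S := by
    intro m n hmn x hx
    have h1 : (m : ℝ) ≤ n := by exact_mod_cast hmn
    simp only [hS, mem_Iic] at hx ⊢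
    linarith
  have hS0 : S 0 ⊆ Iio 0 := by
    intro x hx; simp only [hS, mem_Iic, Nat.cast_zero] at hx; simp only [mem_Iio]; linarith
  have hfi : ∃ n, IntegrableOn b (S n) := ⟨0, hint.mono_set hS0⟩
  have hlim := tendsto_setIntegral_of_antitone hsm hanti hfi
  have hempty : (⋂ n, S n) = ∅ := by
    ext x
    simp only [mem_iInter, hS, mem_Iic, mem_empty_iff_false, iff_false, not_forall, not_le]
    obtain ⟨n, hn⟩ := exists_nat_gt (-x - 1)
    exact ⟨n, by linarith⟩
  rw [hempty, Measure.restrict_empty, integral_zero_measure] at hlim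
  set ε' : ℝ := (s - 1) * ε / s with hε'
  have hε'pos : 0 < ε' := by rw [hε']; exact div_pos (mul_pos (by linarith) hε) hs0
  obtain ⟨N, hN⟩ := (tendsto_order.1 hlim).2 ε' hε'pos |>.exists_forall_of_atTop
  set T₁ : ℝ := -(N : ℝ) - 1 with hT₁
  have hT₁neg : T₁ < 0 := by rw [hT₁]; linarith [(Nat.cast_nonneg N : (0 : ℝ) ≤ N)]
  -- for `t ≤ T₁`: `(s-1)|t| b(st) ≤ ∫_{[st,t]} b ≤ ∫_{S N} b < ε'`
  have hkey : ∀ t : ℝ, t ≤ T₁ → (s - 1) * (-t) * b (s * t) ≤ ε' := by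
    intro t ht
    have ht0 : t < 0 := lt_of_le_of_lt ht hT₁neg
    have hst : s * t ≤ t := by nlinarith
    have hsub1 : Icc (s * t) t ⊆ S N := fun x hx => hx.2.trans ht
    have hsub0 : Icc (s * t) t ⊆ Iic 0 := fun x hx => hx.2.trans ht0.le
    have hintI : IntegrableOn b (Icc (s * t) t) := hint.mono_set (hsub1.trans ((hanti (Nat.zero_le N)).trans hS0))
    have hconst : ∫ x in Icc (s * t) t, b (s * t) = (t - s * t) * b (s * t) := by
      rw [setIntegral_const, Real.volume_real_Icc_of_le hst, smul_eq_mul]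
    have h1 : ∫ x in Icc (s * t) t, b (s * t) ≤ ∫ x in Icc (s * t) t, b x := by
      refine setIntegral_mono_on ?_ hintI measurableSet_Icc ?_
      · exact (continuous_const.integrableOn_Icc)
      · intro x hx
        exact hmono (hsub0 ⟨le_rfl, hst⟩) (hsub0 hx) hx.1
    have h2 : ∫ x in Icc (s * t) t, b x ≤ ∫ x in S N, b x := by
      refine setIntegral_mono_set (hint.mono_set ((hanti (Nat.zero_le N)).trans hS0)) ?_
        (Eventually.of_forall hsub1)
      refine ae_restrict_of_forall_mem (hsm N) ?_
      intro x hx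
      exact hnonneg x (hS0 (hanti (Nat.zero_le N) hx)).le
    have h3 : ∫ x in S N, b x < ε' := hN N le_rfl
    rw [hconst] at h1
    have : (s - 1) * (-t) * b (s * t) = (t - s * t) * b (s * t) := by ring
    linarith
  refine ⟨s * T₁, mul_neg_of_pos_of_neg hs0 hT₁neg, ?_⟩
  intro τ hτ
  have hτs : τ / s ≤ T₁ := by rw [div_le_iff₀ hs0]; linarith
  have h := hkey (τ / s) hτs
  have hsd : s * (τ / s) = τ := mul_div_cancel₀ τ hs0.ne'
  rw [hsd] at h
  have hs1' : 0 < s - 1 := by linarith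
  have hτ0 : τ ≤ 0 := hτ.trans (mul_neg_of_pos_of_neg hs0 hT₁neg).le
  have hb : 0 ≤ b τ := hnonneg τ hτ0
  -- `(-τ) b τ = s/(s-1) · ((s-1)(-τ/s) b τ) ≤ s ε'/(s-1) = ε`
  have h4 : (s - 1) * (-(τ / s)) * b τ = (s - 1) / s * ((-τ) * b τ) := by
    field_simp
  rw [h4] at h
  have h5 : (-τ) * b τ ≤ ε' / ((s - 1) / s) := by
    rw [le_div_iff₀ (div_pos hs1' hs0)]; linarith
  have h6 : ε' / ((s - 1) / s) = ε := by
    rw [hε']; field_simp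
  linarith

end WakeRatchetRelayDrainFreeSlow

end Summit.NavierStokesRegularity.NavierStokesRegularity.Theorems

end
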